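import Summits.AtomisticToContinuum.Crystallization.Theorems.PalmUnimodularRigidityMinimiserShellsSplit
import Summits.AtomisticToContinuum.Crystallization.Theorems.PalmUnimodularRigidityMinimiserShellsShellGapConjecture
import HarnessLib.Audit

/-!
# Crux `MinimiserShells` (stmt-AtomisticToContinuum-9225): the EXACT coarse / coarse-to-fine split

Route `PalmUnimodularRigidity`, crux decl
`Summit.AtomisticToContinuum.Crystallization.Theses.PalmUnimodularRigidity.MinimiserShells`
(strategist seat `cstrat-stmt-AtomisticToContinuum-9225-s1`, 2026-08-17; successor of the `θ = 0` split of seat `…-p1`,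
`Split.lean`, p137618).

Since skeleton r5 the crux is kernel-certified EQUAL to its loosened residual,
`MinimiserShells ↔ ∀ θ ∈ (0, 1/10], Residual.ShellGap θ` (`ExactResidual.minimiserShells_iff_shellGapAll`, p149424),
so the strategist split can now be made EXACT — both children NECESSARY for the crux, jointly SUFFICIENT:

* child 1 `Split.CoarseShellGapStmt` = `Residual.ShellGap (1/20)` (unchanged: the COARSE hard-core periodic first-shell
  gap for three-dimensional Lennard-Jones 12-6 — the open core, Blanc–Lewin 2015 §2.3; necessary by p123347);
* child 2 `CoarseToFineShellGapAllStmt` (NEW, replaces the `θ = 0` child `Split.CoarseToFineShellGapStmt`): for EVERY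
  loosening `θ ∈ (0, 1/20]` and every `t > 0` there are `s > 0`, `κ > 0` such that a `1/3`-separated periodic `Q` with at
  least `t·#motif` `θ`-loosely badly shelled sites but fewer than `s·#motif` `(1/20)`-loosely (coarsely) badly shelled
  sites has `e(Q) ≥ e* + κ`.  It is WEAKER than the `θ = 0` child (`coarseToFineShellGapAll_of_coarseToFineShellGap`,
  antitonicity of the loose bad counts) and, unlike it, NECESSARY for the crux (`exactSubs_of_minimiserShells`): the
  closed-tolerance-boundary caveat of the `θ = 0` cut is gone.  Content: the e*-free elastic regime (competitors are
  coarsely close-packed off an `s`-sparse set, `e*` enters only through `e* ≤ e(reference stacking)`).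

Theorems: `coarseToFineShellGapAllStmt_iff` (`Iff.rfl` against the residual vocabulary),
`shellGapAll_of_exactSubs` (children ⇒ `∀ θ ∈ (0, 1/10], ShellGap θ`: case split at the coarse threshold `s(θ, t)` for
`θ ≤ 1/20`, `Residual.shellGap_mono` above `1/20`), **`minimiserShells_of_exactSubs`** (the GLUE of the split),
`exactSubs_of_minimiserShells` (both children necessary), `minimiserShells_iff_exactSubs` (the split is exact),
`lennardJonesShellGapConjecture_iff_exactSubs`, `minimiserShells_of_exactSubs'` (the glue over the children's literal
statement texts, for `ledger route edit --split MinimiserShells --glue-by`), and the named open core of child 1 ALONE,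
`LennardJonesCoarseShellGapConjecture` (`@[conjecture] def`, Literature vocabulary, never asserted) with
`lennardJonesCoarseShellGapConjecture_iff_coarseShellGap` — so that a tenure planner / the human can carry exactly the
weakest certified-necessary open statement as a conditional bridge while child 2 is worked.
-/

noncomputable section

open MeasureTheory
open scoped ENNReal BigOperators Classical

namespace Summit.AtomisticToContinuum.Crystallization.Theorems.PalmUnimodularRigidityMinimiserShells.ExactSplit

open Literature.MathematicalPhysics.StatisticalMechanics (lennardJones PeriodicConfiguration)
open Summit.AtomisticToContinuum.Crystallization.Theses.PalmUnimodularRigidity (MinimiserShells)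
open Literature.Geometry.DiscreteGeometry (ShellCloseTo fccKissingPattern hcpKissingPattern)
open Summit.AtomisticToContinuum.Crystallization.Theorems.MinimiserShells.Negative.LoadBearing (eStar GoodShell)
open Summit.AtomisticToContinuum.Crystallization.Theorems.PalmUnimodularRigidityMinimiserShells.Residual
  (ShellGap IsSepThird looseBadMotifCount LooseGoodShell rerooted looseBadMotifCount_zero looseBadMotifCount_anti
   shellGap_mono shellGap_of_minimiserShells)
open Summit.AtomisticToContinuum.Crystallization.Theorems.PalmUnimodularRigidityMinimiserShells.Split
  (CoarseShellGapStmt CoarseToFineShellGapStmt coarseShellGapStmt_iff coarseToFineShellGapStmt_iff)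
open Summit.AtomisticToContinuum.Crystallization.Theorems.PalmUnimodularRigidityMinimiserShells.ExactResidual
  (minimiserShells_iff_shellGapAll minimiserShells_of_shellGapAll)
open Summit.AtomisticToContinuum.Crystallization
  (LennardJonesShellGapConjecture lennardJonesShellGapConjecture_iff_shellGapAll)

/-- **Child 2 (exact form) — the COARSE-TO-FINE gap at every loosening level** (statement text of the route child
`CoarseToFineShellGapAll`).  For every `θ ∈ (0, 1/20]` and every `t > 0` there are `s > 0` and `κ > 0` such that every
periodic configuration `Q` of `ℝ³` with `1/3`-separated points, at least `t·#motif` motif sites failing the `θ`-LOOSENED shell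
test (tolerance `a/100 + θ`, radius `(5/4 − θ)·a`, some scale `a ∈ [9/10, 1]`, FCC or HCP pattern) and FEWER than `s·#motif`
motif sites failing the COARSE test (tolerance `a/100 + 1/20`, radius `(5/4 − 1/20)·a`) has energy per particle `≥ e* + κ`. -/
def CoarseToFineShellGapAllStmt : Prop :=
  ∀ θ : ℝ, 0 < θ → θ ≤ 1 / 20 → ∀ t : ℝ, 0 < t → ∃ s : ℝ, 0 < s ∧ ∃ κ : ℝ, 0 < κ ∧
    ∀ Q : Literature.MathematicalPhysics.StatisticalMechanics.PeriodicConfiguration 3,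
      (∀ p ∈ Q.points, ∀ q ∈ Q.points, p ≠ q → (1 : ℝ) / 3 ≤ dist p q) →
      t * (Q.motif.card : ℝ) ≤ (Nat.card {x : Q.motif // ¬ (∃ a : ℝ, 9 / 10 ≤ a ∧ a ≤ 1 ∧
          ∃ T : Finset (EuclideanSpace ℝ (Fin 3)),
          (↑T : Set (EuclideanSpace ℝ (Fin 3))) = {w : EuclideanSpace ℝ (Fin 3) |
            ((MeasureTheory.Measure.count : MeasureTheory.Measure (EuclideanSpace ℝ (Fin 3))).restrict
              ((fun z => z - (x : EuclideanSpace ℝ (Fin 3))) '' Q.points)) {w} ≠ 0 ∧ w ≠ 0 ∧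
              ‖w‖ ≤ (5 / 4 - θ) * a} ∧
          (Literature.Geometry.DiscreteGeometry.ShellCloseTo (a / 100 + θ) T
            (Finset.image (fun v : EuclideanSpace ℝ (Fin 3) => a • v)
              Literature.Geometry.DiscreteGeometry.fccKissingPattern) ∨
           Literature.Geometry.DiscreteGeometry.ShellCloseTo (a / 100 + θ) T
            (Finset.image (fun v : EuclideanSpace ℝ (Fin 3) => a • v)
              Literature.Geometry.DiscreteGeometry.hcpKissingPattern)))} : ℝ) →
      (Nat.card {x : Q.motif // ¬ (∃ a : ℝ, 9 / 10 ≤ a ∧ a ≤ 1 ∧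
          ∃ T : Finset (EuclideanSpace ℝ (Fin 3)),
          (↑T : Set (EuclideanSpace ℝ (Fin 3))) = {w : EuclideanSpace ℝ (Fin 3) |
            ((MeasureTheory.Measure.count : MeasureTheory.Measure (EuclideanSpace ℝ (Fin 3))).restrict
              ((fun z => z - (x : EuclideanSpace ℝ (Fin 3))) '' Q.points)) {w} ≠ 0 ∧ w ≠ 0 ∧
              ‖w‖ ≤ (5 / 4 - 1 / 20) * a} ∧
          (Literature.Geometry.DiscreteGeometry.ShellCloseTo (a / 100 + 1 / 20) T
            (Finset.image (fun v : EuclideanSpace ℝ (Fin 3) => a • v)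
              Literature.Geometry.DiscreteGeometry.fccKissingPattern) ∨
           Literature.Geometry.DiscreteGeometry.ShellCloseTo (a / 100 + 1 / 20) T
            (Finset.image (fun v : EuclideanSpace ℝ (Fin 3) => a • v)
              Literature.Geometry.DiscreteGeometry.hcpKissingPattern)))} : ℝ) <
        s * (Q.motif.card : ℝ) →
      (⨅ P : Literature.MathematicalPhysics.StatisticalMechanics.PeriodicConfiguration 3,
          P.energyPerParticle Literature.MathematicalPhysics.StatisticalMechanics.lennardJones) + κ ≤
        Q.energyPerParticle Literature.MathematicalPhysics.StatisticalMechanics.lennardJones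

/-! ## Read-back against the residual vocabulary -/

/-- Child 2 in the residual vocabulary: level-`θ` bad count = `looseBadMotifCount θ`, coarse-bad count =
`looseBadMotifCount (1/20)`. -/
theorem coarseToFineShellGapAllStmt_iff :
    CoarseToFineShellGapAllStmt ↔
    (∀ θ : ℝ, 0 < θ → θ ≤ 1 / 20 → ∀ t : ℝ, 0 < t → ∃ s : ℝ, 0 < s ∧ ∃ κ : ℝ, 0 < κ ∧
      ∀ Q : PeriodicConfiguration 3, IsSepThird Q →
      t * (Q.motif.card : ℝ) ≤ (looseBadMotifCount θ Q : ℝ) →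
      (looseBadMotifCount (1 / 20) Q : ℝ) < s * (Q.motif.card : ℝ) →
      eStar + κ ≤ Q.energyPerParticle lennardJones) :=
  Iff.rfl

/-! ## The glue: the two children give every loosened gap, hence the crux -/

/-- **The two children give `ShellGap θ` for every `θ ∈ (0, 1/10]`.**  For `θ ≤ 1/20`: given `t`, take `s, κ₂` from
child 2 at level `θ` and `κ₁` from child 1 at threshold `s`; a `Q` with `t`-many `θ`-bad sites has coarse-bad fraction
`≥ s` (child 1: gap `κ₁`) or `< s` (child 2: gap `κ₂`).  For `θ > 1/20`: monotonicity of `ShellGap` from child 1. -/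
theorem shellGapAll_of_exactSubs (h₁ : CoarseShellGapStmt) (h₂ : CoarseToFineShellGapAllStmt) :
    ∀ θ : ℝ, 0 < θ → θ ≤ 1 / 10 → ShellGap θ := by
  rw [coarseShellGapStmt_iff] at h₁
  rw [coarseToFineShellGapAllStmt_iff] at h₂
  intro θ hθ hθ'
  by_cases hle : θ ≤ 1 / 20
  · intro t ht
    obtain ⟨s, hs, κ₂, hκ₂, H₂⟩ := h₂ θ hθ hle t ht
    obtain ⟨κ₁, hκ₁, H₁⟩ := h₁ s hs
    refine ⟨min κ₁ κ₂, lt_min hκ₁ hκ₂, fun Q hsep hbad => ?_⟩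
    by_cases hc : s * (Q.motif.card : ℝ) ≤ (looseBadMotifCount (1 / 20) Q : ℝ)
    · exact le_trans (add_le_add le_rfl (min_le_left κ₁ κ₂)) (H₁ Q hsep hc)
    · exact le_trans (add_le_add le_rfl (min_le_right κ₁ κ₂)) (H₂ Q hsep hbad (not_le.mp hc))
  · exact shellGap_mono (1 / 20) θ (by norm_num) (le_of_lt (not_le.mp hle)) hθ' h₁

/-- **GLUE OF THE EXACT SPLIT: `CoarseShellGap → CoarseToFineShellGapAll → MinimiserShells`.** -/
theorem minimiserShells_of_exactSubs : CoarseShellGapStmt → CoarseToFineShellGapAllStmt → MinimiserShells :=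
  fun h₁ h₂ => minimiserShells_of_shellGapAll (shellGapAll_of_exactSubs h₁ h₂)

/-! ## The split is exact: both children are necessary -/

/-- The loosened gaps give back both children (child 1 at `θ = 1/20`; child 2 by dropping the sparsity hypothesis). -/
theorem exactSubs_of_shellGapAll (h : ∀ θ : ℝ, 0 < θ → θ ≤ 1 / 10 → ShellGap θ) :
    CoarseShellGapStmt ∧ CoarseToFineShellGapAllStmt := by
  refine ⟨coarseShellGapStmt_iff.2 (h (1 / 20) (by norm_num) (by norm_num)), ?_⟩
  rw [coarseToFineShellGapAllStmt_iff]
  intro θ hθ hθ20 t ht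
  obtain ⟨κ, hκ, H⟩ := h θ hθ (hθ20.trans (by norm_num)) t ht
  exact ⟨1, one_pos, κ, hκ, fun Q hsep hbad _ => H Q hsep hbad⟩

/-- **Both children are NECESSARY for the crux** (p123347 through `ExactResidual.minimiserShells_iff_shellGapAll`). -/
theorem exactSubs_of_minimiserShells (h : MinimiserShells) : CoarseShellGapStmt ∧ CoarseToFineShellGapAllStmt :=
  exactSubs_of_shellGapAll (minimiserShells_iff_shellGapAll.1 h)

/-- The loosened residual is equivalent to the conjunction of the two children. -/
theorem shellGapAll_iff_exactSubs :
    (∀ θ : ℝ, 0 < θ → θ ≤ 1 / 10 → ShellGap θ) ↔ CoarseShellGapStmt ∧ CoarseToFineShellGapAllStmt :=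
  ⟨exactSubs_of_shellGapAll, fun h => shellGapAll_of_exactSubs h.1 h.2⟩

/-- **The crux is EQUIVALENT to the conjunction of the two children**: the split loses nothing. -/
theorem minimiserShells_iff_exactSubs : MinimiserShells ↔ CoarseShellGapStmt ∧ CoarseToFineShellGapAllStmt :=
  minimiserShells_iff_shellGapAll.trans shellGapAll_iff_exactSubs

/-- The named open core `LennardJonesShellGapConjecture` (p154555) is the conjunction of the two children. -/
theorem lennardJonesShellGapConjecture_iff_exactSubs :
    LennardJonesShellGapConjecture ↔ CoarseShellGapStmt ∧ CoarseToFineShellGapAllStmt :=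
  lennardJonesShellGapConjecture_iff_shellGapAll.trans shellGapAll_iff_exactSubs

/-- The `θ = 0` child of the earlier split (`Split.CoarseToFineShellGapStmt`, p137618) IMPLIES the exact child 2
(antitonicity of the loose bad counts in the level): child 2 got weaker, not stronger. -/
theorem coarseToFineShellGapAll_of_coarseToFineShellGap (h : CoarseToFineShellGapStmt) :
    CoarseToFineShellGapAllStmt := by
  rw [coarseToFineShellGapStmt_iff] at h
  rw [coarseToFineShellGapAllStmt_iff]
  intro θ hθ hθ20 t ht
  obtain ⟨s, hs, κ, hκ, H⟩ := h t ht
  refine ⟨s, hs, κ, hκ, fun Q hsep hbad hcoarse => H Q hsep (hbad.trans ?_) hcoarse⟩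
  exact_mod_cast looseBadMotifCount_anti le_rfl hθ.le (hθ20.trans (by norm_num)) Q

/-! ## The glue over the children's literal statement texts (for `route edit --split … --glue-by`) -/

/-- The glue with both hypotheses written out literally (the statement texts of the route children `CoarseShellGap` and
`CoarseToFineShellGapAll`). -/
theorem minimiserShells_of_exactSubs' :
    (∀ t : ℝ, 0 < t → ∃ κ : ℝ, 0 < κ ∧
      ∀ Q : Literature.MathematicalPhysics.StatisticalMechanics.PeriodicConfiguration 3,
        (∀ p ∈ Q.points, ∀ q ∈ Q.points, p ≠ q → (1 : ℝ) / 3 ≤ dist p q) →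
        t * (Q.motif.card : ℝ) ≤ (Nat.card {x : Q.motif // ¬ (∃ a : ℝ, 9 / 10 ≤ a ∧ a ≤ 1 ∧
            ∃ T : Finset (EuclideanSpace ℝ (Fin 3)),
            (↑T : Set (EuclideanSpace ℝ (Fin 3))) = {w : EuclideanSpace ℝ (Fin 3) |
              ((MeasureTheory.Measure.count : MeasureTheory.Measure (EuclideanSpace ℝ (Fin 3))).restrict
                ((fun z => z - (x : EuclideanSpace ℝ (Fin 3))) '' Q.points)) {w} ≠ 0 ∧ w ≠ 0 ∧
                ‖w‖ ≤ (5 / 4 - 1 / 20) * a} ∧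
            (Literature.Geometry.DiscreteGeometry.ShellCloseTo (a / 100 + 1 / 20) T
              (Finset.image (fun v : EuclideanSpace ℝ (Fin 3) => a • v)
                Literature.Geometry.DiscreteGeometry.fccKissingPattern) ∨
             Literature.Geometry.DiscreteGeometry.ShellCloseTo (a / 100 + 1 / 20) T
              (Finset.image (fun v : EuclideanSpace ℝ (Fin 3) => a • v)
                Literature.Geometry.DiscreteGeometry.hcpKissingPattern)))} : ℝ) →
        (⨅ P : Literature.MathematicalPhysics.StatisticalMechanics.PeriodicConfiguration 3,
            P.energyPerParticle Literature.MathematicalPhysics.StatisticalMechanics.lennardJones) + κ ≤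
          Q.energyPerParticle Literature.MathematicalPhysics.StatisticalMechanics.lennardJones) →
    (∀ θ : ℝ, 0 < θ → θ ≤ 1 / 20 → ∀ t : ℝ, 0 < t → ∃ s : ℝ, 0 < s ∧ ∃ κ : ℝ, 0 < κ ∧
      ∀ Q : Literature.MathematicalPhysics.StatisticalMechanics.PeriodicConfiguration 3,
        (∀ p ∈ Q.points, ∀ q ∈ Q.points, p ≠ q → (1 : ℝ) / 3 ≤ dist p q) →
        t * (Q.motif.card : ℝ) ≤ (Nat.card {x : Q.motif // ¬ (∃ a : ℝ, 9 / 10 ≤ a ∧ a ≤ 1 ∧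
            ∃ T : Finset (EuclideanSpace ℝ (Fin 3)),
            (↑T : Set (EuclideanSpace ℝ (Fin 3))) = {w : EuclideanSpace ℝ (Fin 3) |
              ((MeasureTheory.Measure.count : MeasureTheory.Measure (EuclideanSpace ℝ (Fin 3))).restrict
                ((fun z => z - (x : EuclideanSpace ℝ (Fin 3))) '' Q.points)) {w} ≠ 0 ∧ w ≠ 0 ∧
                ‖w‖ ≤ (5 / 4 - θ) * a} ∧
            (Literature.Geometry.DiscreteGeometry.ShellCloseTo (a / 100 + θ) T
              (Finset.image (fun v : EuclideanSpace ℝ (Fin 3) => a • v)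
                Literature.Geometry.DiscreteGeometry.fccKissingPattern) ∨
             Literature.Geometry.DiscreteGeometry.ShellCloseTo (a / 100 + θ) T
              (Finset.image (fun v : EuclideanSpace ℝ (Fin 3) => a • v)
                Literature.Geometry.DiscreteGeometry.hcpKissingPattern)))} : ℝ) →
        (Nat.card {x : Q.motif // ¬ (∃ a : ℝ, 9 / 10 ≤ a ∧ a ≤ 1 ∧
            ∃ T : Finset (EuclideanSpace ℝ (Fin 3)),
            (↑T : Set (EuclideanSpace ℝ (Fin 3))) = {w : EuclideanSpace ℝ (Fin 3) |
              ((MeasureTheory.Measure.count : MeasureTheory.Measure (EuclideanSpace ℝ (Fin 3))).restrict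
                ((fun z => z - (x : EuclideanSpace ℝ (Fin 3))) '' Q.points)) {w} ≠ 0 ∧ w ≠ 0 ∧
                ‖w‖ ≤ (5 / 4 - 1 / 20) * a} ∧
            (Literature.Geometry.DiscreteGeometry.ShellCloseTo (a / 100 + 1 / 20) T
              (Finset.image (fun v : EuclideanSpace ℝ (Fin 3) => a • v)
                Literature.Geometry.DiscreteGeometry.fccKissingPattern) ∨
             Literature.Geometry.DiscreteGeometry.ShellCloseTo (a / 100 + 1 / 20) T
              (Finset.image (fun v : EuclideanSpace ℝ (Fin 3) => a • v)
                Literature.Geometry.DiscreteGeometry.hcpKissingPattern)))} : ℝ) <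
          s * (Q.motif.card : ℝ) →
        (⨅ P : Literature.MathematicalPhysics.StatisticalMechanics.PeriodicConfiguration 3,
            P.energyPerParticle Literature.MathematicalPhysics.StatisticalMechanics.lennardJones) + κ ≤
          Q.energyPerParticle Literature.MathematicalPhysics.StatisticalMechanics.lennardJones) →
    MinimiserShells :=
  minimiserShells_of_exactSubs

end Summit.AtomisticToContinuum.Crystallization.Theorems.PalmUnimodularRigidityMinimiserShells.ExactSplit

/-! ## The named open core of child 1 alone -/

namespace Summit.AtomisticToContinuum.Crystallization

open Literature.MathematicalPhysics.StatisticalMechanics (lennardJones PeriodicConfiguration)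
open Literature.Geometry.DiscreteGeometry (ShellCloseTo fccKissingPattern hcpKissingPattern)
open Summit.AtomisticToContinuum.Crystallization.Theorems.PalmUnimodularRigidityMinimiserShells.ShellNoBoundary
  (count_restrict_image_sub_singleton_ne_zero_iff)
open Summit.AtomisticToContinuum.Crystallization.Theses.PalmUnimodularRigidity (MinimiserShells)
open Summit.AtomisticToContinuum.Crystallization.Theorems.MinimiserShells.Negative.LoadBearing (eStar)
open Summit.AtomisticToContinuum.Crystallization.Theorems.PalmUnimodularRigidityMinimiserShells.Residual
  (ShellGap IsSepThird looseBadMotifCount LooseGoodShell rerooted shellGap_of_minimiserShells)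
open Summit.AtomisticToContinuum.Crystallization.Theorems.PalmUnimodularRigidityMinimiserShells.Split
  (CoarseShellGapStmt coarseShellGapStmt_iff)
open Summit.AtomisticToContinuum.Crystallization.Theorems.PalmUnimodularRigidityMinimiserShells.ExactSplit
  (CoarseToFineShellGapAllStmt minimiserShells_iff_exactSubs)

/-- **The COARSE Lennard-Jones hard-core periodic first-shell gap conjecture** (one loosening level, `θ = 1/20`): for every
`t > 0` there is `κ > 0` such that every periodic configuration `Q` of `ℝ³` with `1/3`-separated points, in which at least
`t·#motif` motif sites `x` fail the COARSE close-packing test — "for some scale `a ∈ [9/10, 1]`, the finite set of offsets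
`w ≠ 0` with `w + x ∈ Q.points` and `‖w‖ ≤ (5/4 − 1/20)·a` is `(a/100 + 1/20)`-matched, after a linear isometry, to the
`a`-scaled FCC or HCP kissing pattern" — has Lennard-Jones energy per particle at least `(⨅_R e_LJ(R)) + κ`.  Bulk energetic
crystallization of three-dimensional Lennard-Jones 12-6 in COARSE periodic first-shell form (first shells more than ≈ 6 %
away from close packing cost energy above the periodic infimum): child 1 of the exact strategist split of crux
`MinimiserShells` of route `PalmUnimodularRigidity`, kernel-certified NECESSARY for that crux (p123347) and the weakest
member of the residual family the crux provably cannot avoid; the complementary child `CoarseToFineShellGapAll` is the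
e*-free elastic regime.  The crystallization problem for Lennard-Jones in `d = 3` is open (Blanc–Lewin 2015, §2.3); this
coarse first-shell form is this programme's (2026-08), not a published statement.  A `def`, never asserted.
[cite: BlancLewin2015, §2.3]
[status: open] -/
@[conjecture] def LennardJonesCoarseShellGapConjecture : Prop :=
  ∀ t : ℝ, 0 < t → ∃ κ : ℝ, 0 < κ ∧
    ∀ Q : PeriodicConfiguration 3,
      (∀ p ∈ Q.points, ∀ q ∈ Q.points, p ≠ q → (1 : ℝ) / 3 ≤ dist p q) →
      t * (Q.motif.card : ℝ) ≤
        (Nat.card {x : Q.motif // ¬ ∃ a : ℝ, 9 / 10 ≤ a ∧ a ≤ 1 ∧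
          ∃ T : Finset (EuclideanSpace ℝ (Fin 3)),
            (↑T : Set (EuclideanSpace ℝ (Fin 3))) =
              {w : EuclideanSpace ℝ (Fin 3) |
                w + (x : EuclideanSpace ℝ (Fin 3)) ∈ Q.points ∧ w ≠ 0 ∧ ‖w‖ ≤ (5 / 4 - 1 / 20) * a} ∧
            (ShellCloseTo (a / 100 + 1 / 20) T
               (Finset.image (fun v : EuclideanSpace ℝ (Fin 3) => a • v) fccKissingPattern) ∨
             ShellCloseTo (a / 100 + 1 / 20) T
               (Finset.image (fun v : EuclideanSpace ℝ (Fin 3) => a • v) hcpKissingPattern))} : ℝ) →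
      (⨅ R : PeriodicConfiguration 3, R.energyPerParticle lennardJones) + κ ≤ Q.energyPerParticle lennardJones

/-- **The coarse conjecture IS `Residual.ShellGap (1/20)`** (= child 1 `Split.CoarseShellGapStmt`). -/
theorem lennardJonesCoarseShellGapConjecture_iff_shellGap :
    LennardJonesCoarseShellGapConjecture ↔ ShellGap (1 / 20) := by
  simp only [LennardJonesCoarseShellGapConjecture, ShellGap, IsSepThird, looseBadMotifCount, LooseGoodShell, rerooted,
    eStar, count_restrict_image_sub_singleton_ne_zero_iff]

/-- The coarse conjecture is, up to unfolding, child 1 `Split.CoarseShellGapStmt` of the strategist split. -/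
theorem lennardJonesCoarseShellGapConjecture_iff_coarseShellGap :
    LennardJonesCoarseShellGapConjecture ↔ CoarseShellGapStmt :=
  lennardJonesCoarseShellGapConjecture_iff_shellGap.trans coarseShellGapStmt_iff.symm

/-- **The coarse conjecture is NECESSARY for the crux `MinimiserShells`** (stmt-AtomisticToContinuum-9225). -/
theorem lennardJonesCoarseShellGapConjecture_of_minimiserShells (h : MinimiserShells) :
    LennardJonesCoarseShellGapConjecture :=
  lennardJonesCoarseShellGapConjecture_iff_shellGap.2 (shellGap_of_minimiserShells h (by norm_num) (by norm_num))

/-- **Conditional closure of the crux on the coarse conjecture**: given the e*-free child 2 (`CoarseToFineShellGapAll`),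
the coarse conjecture gives `MinimiserShells` — the glue a planner cites when carrying child 1 as a conditional bridge. -/
theorem minimiserShells_of_lennardJonesCoarseShellGapConjecture (h₁ : LennardJonesCoarseShellGapConjecture)
    (h₂ : CoarseToFineShellGapAllStmt) : MinimiserShells :=
  minimiserShells_iff_exactSubs.2 ⟨lennardJonesCoarseShellGapConjecture_iff_coarseShellGap.1 h₁, h₂⟩

/-- The crux is equivalent to (coarse conjecture ∧ exact child 2). -/
theorem minimiserShells_iff_coarseConjecture_and_coarseToFine :
    MinimiserShells ↔ LennardJonesCoarseShellGapConjecture ∧ CoarseToFineShellGapAllStmt := by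
  rw [minimiserShells_iff_exactSubs, lennardJonesCoarseShellGapConjecture_iff_coarseShellGap]

end Summit.AtomisticToContinuum.Crystallization

end
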